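import Literature.MathematicalPhysics.QuantumFieldTheory.Balaban1983to89.B8Thm2TorusAt
import Literature.MathematicalPhysics.QuantumFieldTheory.Balaban1983to89.B8Ineq130
import HarnessLib

/-!
# Route `UnitScaleTilt`, crux K1 child «MinimiserStabilityRegPr» (stmt-QuantumFields-19200) — DOOR-VACUITY CERTIFICATE, FILE B-I: **LONGITUDINAL LINE FIELDS ON
# `ℤᵈ` AT THE TRIVIAL BACKGROUND — the stencils (1.1), (3.4), (3.23), (1.2), (3.19)ᵀ of [B8]∕[B9] EVALUATED, and the print clauses (1.36), (1.38), (1.39) for them**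

Cell `ym3-torus`, width seat `ym3-torus-px4` (gen 6).  THEOREMS ONLY (0 `def`, 0 `sorry`).  ★★OWNER ym3-torus-plan g29 RULING №16 (5), ★ ym-ust-19200-p1 g17 WORD 21 (b)
GO; LOCATE `ym3-torus-px4/g6/LOCATE-VACUITY-CERT-px4g6.md` §1 [C6]–[C8].  YM₃ on T³ is a ladder rung (R3), not d = 4, not Clay; nothing of `hcoW`∕`hcoS`∕E′∕EX∕the crux is
claimed; `--supports stmt-QuantumFields-19200`, count-neutral.

THE OBJECT.  A LONGITUDINAL LINE FIELD on `ℤᵈ` with values in a complete normed `ℂ`-algebra `𝔸`: `A z μ := [μ = μ₀]·a(z_{μ₀})` for a direction `μ₀` and an `𝔸`-valued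
profile `a : ℤ → 𝔸` of ONE integer coordinate (displayed by the hypothesis `hA`; this is the based pullback `pull A x₀` of FILE A's torus datum).  At the trivial background
`U₀ = 1` every stencil of [Balaban1985RegularSpaces] (1.1)–(1.2) ∕ [Balaban1985BackgroundPropagators] (3.4), (3.19), (3.23) reads the profile through the coordinate `z_{μ₀}`
alone, because a step `± e_ν`, `ν ≠ μ₀`, does not move it:
* §1 `covDerivFwd`, `covDeriv` (1.1) of a longitudinal SITE function `G z = g(z_{μ₀})`: zero across `ν ≠ μ₀`, the difference quotient of `g` along `μ₀`; `covLap` (3.23) of it is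
  `−η⁻²·(Δ₁g)(z_{μ₀})`; of the line field: `covDivB` (1.1)₂ `= η⁻¹(a(m−1) − a(m))`, `plaqCovDeriv` (3.4) `= 0` (CLOSED), `pdiv` (1.2) of it `= 0`.
* §2 the sup∕gradient∕Hölder∕Laplacian BOUNDS from `‖a m‖ ≤ B`: `‖A‖ ≤ B`, `‖D^η_{1,μ}A_κ‖ ≤ 2|η⁻¹|B`, `hquot η 0 len 1 (D^η_{1,μ}A_κ) q ≤ 4|η⁻¹|B` (`trans 1 = id`,
  ✓`B8Ineq130.hol_one`), `‖Δ^η_1 A_κ‖ ≤ 4η⁻²B`.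
* §3 the clauses at `k = 1` averaging level: ★ `c136T_one_lineField` ((1.36) with `β₀ = 0`, any `B₂ ≥ B₁`, any `len`, from `4|η⁻¹|·(1+|η⁻¹|)·B < B₁·s` and
  `1 ≤ (Lʲη)⁻¹` for `j ≤ 1`), ★ `c139T_one_lineField` ((1.39): the plaquette member is `0 < …`, the Laplacian member from `4η⁻²B < B₁ s`), ★★
  `isLandau138_one_lineField` ((1.38) IN THE MULTIPLIER FORM OF RECORD at `Ω₀ = ℤᵈ`, `Λ = torusLam 1`: `Δ^η_1 D^{η*}_1 A` is the longitudinal site function with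
  profile `η⁻³·S`, `S` the third difference of `a`, and it IS a transpose `Q′₁(1)ᵀμ` as soon as `S` is BLOCK-CONSTANT, `= S(m ∕ L)` — multiplier `μ 1 y := Lᵈ • η⁻³ • S(y_{μ₀})`,
  `μ 0 := 0`; uses `qprimeT1` at background `1` = `L⁻ᵈ • ν(blockMap L ·)` via ✓`bgT_one`).

HONEST SCOPE.  Finite-difference bookkeeping over the tree's own `ℤᵈ` letters at `U₀ = 1`; nothing of Bałaban asserted; no estimate beyond the triangle inequality.

References: T. Bałaban, CMP 99 (1985) 75–102 [Balaban1985RegularSpaces] ((1.1)–(1.2) p.76, (1.36)–(1.38) p.82, (1.39) p.83); CMP 99 (1985) 389–434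
[Balaban1985BackgroundPropagators] ((3.4) p.391, (3.19) p.393, (3.23)–(3.24) p.394, (3.40) p.397).
-/

set_option autoImplicit false
noncomputable section

open scoped BigOperators

namespace Summit.QuantumFields.YangMills.Theorems.Prop7LineFieldZdLetters

open Literature.MathematicalPhysics.QuantumFieldTheory.Balaban1983to89
open B7Prop1Explicit B8Ineq132
open B7Eq78Linearization (conjR conjR_apply)
open B8Ineq132 (one_conjR)
open B8Eq119TwistedAxial (bgT bgT_one)
open B8Thm4TorusAt (torusLam)
open B8Thm2TorusAt (C136T C139T)
open B8Eq146AExpansion (plaqCovDeriv lin X1 X2 X3 X4)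
open B8Eq143PlaqExpansion (pdiv)
open B8Eq138LandauZd (IsLandau138 covLap covDivB QT QprimeT qprimeT1)
open B9Eq340HolderZd (hquot AdmPair trans trans_def)
open Literature.MathematicalPhysics.QuantumLattice (blockMap)

variable {d : ℕ}
variable {𝔸 : Type*} [NormedRing 𝔸] [NormedAlgebra ℂ 𝔸]

/-! ## §1 The stencils at the trivial background on longitudinal fields -/

/-- A step `+e_ν`, `ν ≠ μ₀`, does not move the coordinate `μ₀`. [folklore] -/
theorem add_e_apply_of_ne (z : Site d) {ν μ₀ : Fin d} (h : ν ≠ μ₀) : (z + e ν) μ₀ = z μ₀ := by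
  rw [Pi.add_apply, e_apply, if_neg (Ne.symm h), add_zero]

/-- A step `−e_ν`, `ν ≠ μ₀`, does not move the coordinate `μ₀`. [folklore] -/
theorem sub_e_apply_of_ne (z : Site d) {ν μ₀ : Fin d} (h : ν ≠ μ₀) : (z - e ν) μ₀ = z μ₀ := by
  rw [Pi.sub_apply, e_apply, if_neg (Ne.symm h), sub_zero]

/-- A step `+e_{μ₀}` raises the coordinate `μ₀` by one. [folklore] -/
theorem add_e_apply_self (z : Site d) (μ₀ : Fin d) : (z + e μ₀) μ₀ = z μ₀ + 1 := by
  rw [Pi.add_apply, e_apply, if_pos rfl]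

/-- A step `−e_{μ₀}` lowers the coordinate `μ₀` by one. [folklore] -/
theorem sub_e_apply_self (z : Site d) (μ₀ : Fin d) : (z - e μ₀) μ₀ = z μ₀ - 1 := by
  rw [Pi.sub_apply, e_apply, if_pos rfl]

omit [NormedAlgebra ℂ 𝔸] in
/-- At the trivial background the transporters of (1.1) act trivially: `R(1)Y = Y`. [cite: Balaban1985RegularSpaces, (1.1) p.76] -/
theorem conjR_one_apply (z : Site d) (ν : Fin d) (Y : 𝔸) : conjR ((1 : Site d → Fin d → 𝔸ˣ) z ν) Y = Y := one_conjR Y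

omit [NormedAlgebra ℂ 𝔸] in
/-- … and so do their inverses. [cite: Balaban1985RegularSpaces, (1.1) p.76] -/
theorem conjR_one_inv_apply (z : Site d) (ν : Fin d) (Y : 𝔸) : conjR ((1 : Site d → Fin d → 𝔸ˣ) z ν)⁻¹ Y = Y := by
  rw [show ((1 : Site d → Fin d → 𝔸ˣ) z ν)⁻¹ = 1 from inv_one]; exact one_conjR Y

/-- **(1.1)₁ ACROSS**: the forward covariant derivative at `U₀ = 1` of a longitudinal site function `G z = g(z_{μ₀})` in a direction `ν ≠ μ₀` vanishes.
[cite: Balaban1985RegularSpaces, (1.1) p.76] -/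
theorem covDerivFwd_one_long_of_ne (η : ℝ) {μ₀ ν : Fin d} (h : ν ≠ μ₀) (g : ℤ → 𝔸) {G : Site d → 𝔸} (hG : ∀ z, G z = g (z μ₀)) (z : Site d) :
    covDerivFwd η (1 : Site d → Fin d → 𝔸ˣ) ν G z = 0 := by
  unfold covDerivFwd
  rw [conjR_one_apply, hG, hG, add_e_apply_of_ne z h, sub_self, smul_zero]

/-- **(1.1)₁ ALONG**: in the direction `μ₀` it is the forward difference quotient of the profile. [cite: Balaban1985RegularSpaces, (1.1) p.76] -/
theorem covDerivFwd_one_long_self (η : ℝ) (μ₀ : Fin d) (g : ℤ → 𝔸) {G : Site d → 𝔸} (hG : ∀ z, G z = g (z μ₀)) (z : Site d) :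
    covDerivFwd η (1 : Site d → Fin d → 𝔸ˣ) μ₀ G z = η⁻¹ • (g (z μ₀ + 1) - g (z μ₀)) := by
  unfold covDerivFwd
  rw [conjR_one_apply, hG, hG, add_e_apply_self]

/-- **(1.1)₂ ACROSS**: the backward covariant derivative at `U₀ = 1` of a longitudinal site function in a direction `ν ≠ μ₀` vanishes. [cite: Balaban1985RegularSpaces, (1.1) p.76] -/
theorem covDeriv_one_long_of_ne (η : ℝ) {μ₀ ν : Fin d} (h : ν ≠ μ₀) (g : ℤ → 𝔸) {G : Site d → 𝔸} (hG : ∀ z, G z = g (z μ₀)) (z : Site d) :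
    covDeriv η (1 : Site d → Fin d → 𝔸ˣ) ν G z = 0 := by
  unfold covDeriv
  rw [conjR_one_inv_apply, hG, hG, sub_e_apply_of_ne z h, sub_self, smul_zero]

/-- **(1.1)₂ ALONG**: in the direction `μ₀` it is the backward difference quotient of the profile. [cite: Balaban1985RegularSpaces, (1.1) p.76] -/
theorem covDeriv_one_long_self (η : ℝ) (μ₀ : Fin d) (g : ℤ → 𝔸) {G : Site d → 𝔸} (hG : ∀ z, G z = g (z μ₀)) (z : Site d) :
    covDeriv η (1 : Site d → Fin d → 𝔸ˣ) μ₀ G z = η⁻¹ • (g (z μ₀ - 1) - g (z μ₀)) := by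
  unfold covDeriv
  rw [conjR_one_inv_apply, hG, hG, sub_e_apply_self]

/-- **(3.23) ON A LONGITUDINAL SITE FUNCTION**: `(Δ^η_1 G)(z) = η⁻¹·(η⁻¹(g(m) − g(m−1)) − η⁻¹(g(m+1) − g(m)))`, `m = z_{μ₀}` — minus `η⁻²` times the second
difference of the profile; only the direction `μ₀` contributes. [cite: Balaban1985BackgroundPropagators, (3.23) p.394] -/
theorem covLap_one_long (η : ℝ) (μ₀ : Fin d) (g : ℤ → 𝔸) {G : Site d → 𝔸} (hG : ∀ z, G z = g (z μ₀)) (z : Site d) :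
    covLap η (1 : Site d → Fin d → 𝔸ˣ) G z = η⁻¹ • (η⁻¹ • (g (z μ₀) - g (z μ₀ - 1)) - η⁻¹ • (g (z μ₀ + 1) - g (z μ₀))) := by
  unfold covLap covDivB
  rw [Finset.sum_eq_single μ₀ (fun ν _ hν => ?_) (fun h => absurd (Finset.mem_univ μ₀) h)]
  · -- the `μ₀` term: the backward derivative of the forward difference quotient
    have hD : ∀ w : Site d, covDerivFwd η (1 : Site d → Fin d → 𝔸ˣ) μ₀ G w = (fun m : ℤ => η⁻¹ • (g (m + 1) - g m)) (w μ₀) := fun w =>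
      covDerivFwd_one_long_self η μ₀ g hG w
    rw [covDeriv_one_long_self η μ₀ (fun m : ℤ => η⁻¹ • (g (m + 1) - g m)) hD z]
    simp only [sub_add_cancel]
  · -- the `ν ≠ μ₀` terms: the forward derivative across vanishes identically
    have hD : ∀ w : Site d, covDerivFwd η (1 : Site d → Fin d → 𝔸ˣ) ν G w = (fun _ : ℤ => (0 : 𝔸)) (w μ₀) := fun w =>
      covDerivFwd_one_long_of_ne η hν g hG w
    rw [covDeriv_one_long_of_ne η hν (fun _ : ℤ => (0 : 𝔸)) hD z]

section LineField

variable (η : ℝ) (μ₀ : Fin d) (a : ℤ → 𝔸) {A : Site d → Fin d → 𝔸} (hA : ∀ z μ, A z μ = if μ = μ₀ then a (z μ₀) else 0)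
include hA

omit [NormedAlgebra ℂ 𝔸] in
/-- The `κ`-component of a longitudinal line field is the longitudinal site function with profile `a` (if `κ = μ₀`) or `0`. [cite: Balaban1985RegularSpaces, (1.36) p.82] -/
theorem lineField_component (κ : Fin d) (z : Site d) : A z κ = (fun m : ℤ => if κ = μ₀ then a m else 0) (z μ₀) := by
  rw [hA]

/-- **(1.1)₁ ON THE LINE FIELD**: `D^η_{1,μ}A_κ = [κ = μ₀][μ = μ₀]·η⁻¹(a(m+1) − a(m))`. [cite: Balaban1985RegularSpaces, (1.1) p.76] -/
theorem covDerivFwd_one_lineField (μ κ : Fin d) (z : Site d) :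
    covDerivFwd η (1 : Site d → Fin d → 𝔸ˣ) μ (fun w => A w κ) z = if κ = μ₀ ∧ μ = μ₀ then η⁻¹ • (a (z μ₀ + 1) - a (z μ₀)) else 0 := by
  by_cases hμ : μ = μ₀
  · subst hμ
    rw [covDerivFwd_one_long_self η μ (fun m : ℤ => if κ = μ then a m else 0) (lineField_component μ a hA κ) z]
    by_cases hκ : κ = μ
    · simp only [hκ, if_true, and_self]
    · simp only [hκ, if_false, sub_self, smul_zero, false_and]
  · rw [covDerivFwd_one_long_of_ne η hμ (fun m : ℤ => if κ = μ₀ then a m else 0) (lineField_component μ₀ a hA κ) z]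
    simp only [hμ, and_false, if_false]

/-- **(1.1)₂ SUMMED — THE COVARIANT DIVERGENCE OF THE LINE FIELD**: `(D^{η*}_1 A)(z) = η⁻¹(a(m−1) − a(m))`, `m = z_{μ₀}`. [cite: Balaban1985RegularSpaces, (1.1) p.76, (1.38) p.82] -/
theorem covDivB_one_lineField (z : Site d) : covDivB η (1 : Site d → Fin d → 𝔸ˣ) A z = η⁻¹ • (a (z μ₀ - 1) - a (z μ₀)) := by
  unfold covDivB
  rw [Finset.sum_eq_single μ₀ (fun ν _ hν => ?_) (fun h => absurd (Finset.mem_univ μ₀) h)]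
  · rw [covDeriv_one_long_self η μ₀ (fun m : ℤ => if μ₀ = μ₀ then a m else 0) (lineField_component μ₀ a hA μ₀) z]
    simp only [if_true]
  · rw [covDeriv_one_long_of_ne η hν (fun m : ℤ => if ν = μ₀ then a m else 0) (lineField_component μ₀ a hA ν) z]

/-- **(3.4) — THE LINE FIELD IS CLOSED**: its plaquette covariant derivative at `U₀ = 1` vanishes for every index pair (the two `μ₀`-bonds of a plaquette carry the same value,
the other two carry `0`). [cite: Balaban1985BackgroundPropagators, (3.4) p.391] -/
theorem plaqCovDeriv_one_lineField (μ ν : Fin d) (z : Site d) : plaqCovDeriv η (1 : Site d → Fin d → 𝔸ˣ) A μ ν z = 0 := by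
  unfold plaqCovDeriv lin X1 X2 X3 X4
  rw [conjR_one_apply, conjR_one_apply, hA, hA, hA, hA]
  suffices key : (if μ = μ₀ then a (z μ₀) else 0) + (if ν = μ₀ then a ((z + e μ) μ₀) else 0)
      + -(if μ = μ₀ then a ((z + e ν) μ₀) else 0) + -(if ν = μ₀ then a (z μ₀) else 0) = (0 : 𝔸) by
    rw [key, smul_zero]
  by_cases hμ : μ = μ₀
  · by_cases hν : ν = μ₀
    · have h1 : (z + e μ) μ₀ = z μ₀ + 1 := by rw [hμ]; exact add_e_apply_self z μ₀
      have h2 : (z + e ν) μ₀ = z μ₀ + 1 := by rw [hν]; exact add_e_apply_self z μ₀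
      rw [if_pos hμ, if_pos hν, if_pos hμ, if_pos hν, h1, h2]
      abel
    · have h2 : (z + e ν) μ₀ = z μ₀ := add_e_apply_of_ne z hν
      rw [if_pos hμ, if_neg hν, if_pos hμ, if_neg hν, h2]
      abel
  · by_cases hν : ν = μ₀
    · have h1 : (z + e μ) μ₀ = z μ₀ := add_e_apply_of_ne z hμ
      rw [if_neg hμ, if_pos hν, if_neg hμ, if_pos hν, h1]
      abel
    · rw [if_neg hμ, if_neg hν, if_neg hμ, if_neg hν]
      abel

/-- **(1.2) OF THE CLOSED FIELD**: the covariant divergence of the (vanishing) plaquette derivative vanishes. [cite: Balaban1985RegularSpaces, (1.2) p.76, (1.39) p.83] -/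
theorem pdiv_plaqCovDeriv_one_lineField (μ : Fin d) (z : Site d) : pdiv η (1 : Site d → Fin d → 𝔸ˣ) (plaqCovDeriv η (1 : Site d → Fin d → 𝔸ˣ) A) μ z = 0 := by
  have h0 : plaqCovDeriv η (1 : Site d → Fin d → 𝔸ˣ) A = fun _ _ _ => 0 := by
    funext μ' ν' w; exact plaqCovDeriv_one_lineField η μ₀ a hA μ' ν' w
  rw [h0]
  unfold pdiv
  simp only [B8Eq138LandauZd.covDeriv_zero_fun, Finset.sum_const_zero, sub_self]

/-- **(3.23) ON THE COMPONENTS OF THE LINE FIELD**: `Δ^η_1 A_κ = [κ = μ₀]·η⁻¹(η⁻¹(a(m) − a(m−1)) − η⁻¹(a(m+1) − a(m)))`. [cite: Balaban1985BackgroundPropagators, (3.23) p.394] -/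
theorem covLap_one_lineField (κ : Fin d) (z : Site d) :
    covLap η (1 : Site d → Fin d → 𝔸ˣ) (fun w => A w κ) z =
      if κ = μ₀ then η⁻¹ • (η⁻¹ • (a (z μ₀) - a (z μ₀ - 1)) - η⁻¹ • (a (z μ₀ + 1) - a (z μ₀))) else 0 := by
  rw [covLap_one_long η μ₀ (fun m : ℤ => if κ = μ₀ then a m else 0) (lineField_component μ₀ a hA κ) z]
  by_cases hκ : κ = μ₀
  · simp only [hκ, if_true]
  · simp only [hκ, if_false, sub_self, smul_zero]

/-- **(3.23)∘(1.1)₂ — `Δ^η_1 D^{η*}_1 A`** is the longitudinal site function with profile `m ↦ η⁻¹(η⁻¹(b(m) − b(m−1)) − η⁻¹(b(m+1) − b(m)))`, `b(m) = η⁻¹(a(m−1) − a(m))`.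
[cite: Balaban1985RegularSpaces, (1.38) p.82; Balaban1985BackgroundPropagators, (3.23) p.394] -/
theorem covLap_covDivB_one_lineField (z : Site d) :
    covLap η (1 : Site d → Fin d → 𝔸ˣ) (covDivB η (1 : Site d → Fin d → 𝔸ˣ) A) z =
      η⁻¹ • (η⁻¹ • (η⁻¹ • (a (z μ₀ - 1) - a (z μ₀)) - η⁻¹ • (a (z μ₀ - 1 - 1) - a (z μ₀ - 1)))
        - η⁻¹ • (η⁻¹ • (a (z μ₀ + 1 - 1) - a (z μ₀ + 1)) - η⁻¹ • (a (z μ₀ - 1) - a (z μ₀)))) :=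
  covLap_one_long η μ₀ (fun m : ℤ => η⁻¹ • (a (m - 1) - a m)) (covDivB_one_lineField η μ₀ a hA) z

end LineField

/-! ## §2 Bounds from a bounded profile -/

section Bounds

variable (η : ℝ) (μ₀ : Fin d) (a : ℤ → 𝔸) {A : Site d → Fin d → 𝔸} (hA : ∀ z μ, A z μ = if μ = μ₀ then a (z μ₀) else 0)
  {B : ℝ} (ha : ∀ m, ‖a m‖ ≤ B)
include hA ha

omit [NormedAlgebra ℂ 𝔸] in
/-- `‖A‖ ≤ B`. [cite: Balaban1985RegularSpaces, (1.36) p.82] -/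
theorem norm_lineField_le (z : Site d) (μ : Fin d) : ‖A z μ‖ ≤ B := by
  have hB : 0 ≤ B := (norm_nonneg _).trans (ha 0)
  rw [hA]
  split_ifs
  · exact ha _
  · rw [norm_zero]; exact hB

/-- `‖D^η_{1,μ}A_κ‖ ≤ ‖η⁻¹‖·2B`. [cite: Balaban1985RegularSpaces, (1.36) p.82, (1.1) p.76] -/
theorem norm_covDerivFwd_one_lineField_le (μ κ : Fin d) (z : Site d) :
    ‖covDerivFwd η (1 : Site d → Fin d → 𝔸ˣ) μ (fun w => A w κ) z‖ ≤ ‖η⁻¹‖ * (2 * B) := by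
  have hB : 0 ≤ B := (norm_nonneg _).trans (ha 0)
  rw [covDerivFwd_one_lineField η μ₀ a hA]
  split_ifs
  · refine (norm_smul_le _ _).trans (mul_le_mul_of_nonneg_left ?_ (norm_nonneg _))
    exact (norm_sub_le _ _).trans (by linarith [ha (z μ₀ + 1), ha (z μ₀)])
  · rw [norm_zero]; positivity

/-- **THE HÖLDER QUOTIENT (3.40) AT `β = 0`** of `D^η_{1,μ}A_κ` is at most `‖η⁻¹‖·4B` (the transporter `R(1(Γ_{x,x′})) = id`, ✓`B8Ineq130.hol_one`; weight `(η|x′−x|)⁰ = 1`).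
[cite: Balaban1985BackgroundPropagators, (3.40) p.397] -/
theorem hquot_zero_covDerivFwd_one_lineField_le (len : Site d → ℝ) (μ κ : Fin d) (q : Site d × Site d) :
    hquot η 0 len (1 : Site d → Fin d → 𝔸ˣ) (covDerivFwd η (1 : Site d → Fin d → 𝔸ˣ) μ (fun w => A w κ)) q ≤ ‖η⁻¹‖ * (4 * B) := by
  rw [hquot, trans_def, B8Ineq130.hol_one, one_conjR, Real.rpow_zero, div_one]
  refine (norm_sub_le _ _).trans ?_
  have h1 := norm_covDerivFwd_one_lineField_le η μ₀ a hA ha μ κ q.2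
  have h2 := norm_covDerivFwd_one_lineField_le η μ₀ a hA ha μ κ q.1
  linarith

/-- `‖Δ^η_1 A_κ‖ ≤ ‖η⁻¹‖²·4B`. [cite: Balaban1985RegularSpaces, (1.39) p.83; Balaban1985BackgroundPropagators, (3.23) p.394] -/
theorem norm_covLap_one_lineField_le (κ : Fin d) (z : Site d) :
    ‖covLap η (1 : Site d → Fin d → 𝔸ˣ) (fun w => A w κ) z‖ ≤ ‖η⁻¹‖ * (‖η⁻¹‖ * (4 * B)) := by
  have hB : 0 ≤ B := (norm_nonneg _).trans (ha 0)
  rw [covLap_one_lineField η μ₀ a hA]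
  split_ifs
  · refine (norm_smul_le _ _).trans (mul_le_mul_of_nonneg_left ?_ (norm_nonneg _))
    refine (norm_sub_le _ _).trans ?_
    have h1 : ‖η⁻¹ • (a (z μ₀) - a (z μ₀ - 1))‖ ≤ ‖η⁻¹‖ * (2 * B) :=
      (norm_smul_le _ _).trans (mul_le_mul_of_nonneg_left ((norm_sub_le _ _).trans (by linarith [ha (z μ₀), ha (z μ₀ - 1)])) (norm_nonneg _))
    have h2 : ‖η⁻¹ • (a (z μ₀ + 1) - a (z μ₀))‖ ≤ ‖η⁻¹‖ * (2 * B) :=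
      (norm_smul_le _ _).trans (mul_le_mul_of_nonneg_left ((norm_sub_le _ _).trans (by linarith [ha (z μ₀ + 1), ha (z μ₀)])) (norm_nonneg _))
    linarith
  · rw [norm_zero]; positivity

end Bounds

/-! ## §3 The print clauses (1.36), (1.39), (1.38) for a longitudinal line field at the trivial background -/

section Clauses

variable {η : ℝ} (μ₀ : Fin d) (a : ℤ → 𝔸) {A : Site d → Fin d → 𝔸} (hA : ∀ z μ, A z μ = if μ = μ₀ then a (z μ₀) else 0)
  {B : ℝ} (ha : ∀ m, ‖a m‖ ≤ B)
include hA ha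

/-- ★ **(1.36) `C136T` FOR THE LINE FIELD AT `U₀ = 1`, HÖLDER EXPONENT `β₀ = 0`** (any `len`, any `B₂`): if every `(Lʲη)⁻¹ ≥ 1` for `j ≤ k` (true for `η = L^{−k}`,
`L ≥ 1`) and the profile is small — `B < B₁s`, `‖η⁻¹‖·2B < B₁s`, `‖η⁻¹‖·4B < B₂s` — then the sup, gradient and Hölder members of (1.36) hold at every `j ≤ k`.
[cite: Balaban1985RegularSpaces, (1.36) p.82] -/
theorem c136T_one_lineField {L k : ℕ} (hη1 : ∀ j, j ≤ k → (1 : ℝ) ≤ ((L : ℝ) ^ j * η)⁻¹) {B₁ B₂ s : ℝ} (len : Site d → ℝ)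
    (h1 : B < B₁ * s) (h2 : ‖η⁻¹‖ * (2 * B) < B₁ * s) (h3 : ‖η⁻¹‖ * (4 * B) < B₂ * s) :
    C136T L k η 0 B₁ B₂ len s (1 : Site d → Fin d → 𝔸ˣ) A := by
  have hB : 0 ≤ B := (norm_nonneg _).trans (ha 0)
  have hB₁s : 0 < B₁ * s := lt_of_le_of_lt hB h1
  have hB₂s : 0 < B₂ * s := lt_of_le_of_lt (by positivity) h3
  refine ⟨fun j hj x μ => ?_, fun j hj x μ κ => ?_, fun β hβ0 hβ1 j hj μ κ q _ => ?_⟩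
  · calc ‖A x μ‖ ≤ B := norm_lineField_le μ₀ a hA ha x μ
      _ < B₁ * s := h1
      _ = B₁ * s * 1 := (mul_one _).symm
      _ ≤ B₁ * s * ((L : ℝ) ^ j * η)⁻¹ := mul_le_mul_of_nonneg_left (hη1 j hj) hB₁s.le
  · calc ‖covDerivFwd η (1 : Site d → Fin d → 𝔸ˣ) μ (fun z => A z κ) x‖ ≤ ‖η⁻¹‖ * (2 * B) := norm_covDerivFwd_one_lineField_le η μ₀ a hA ha μ κ x
      _ < B₁ * s := h2
      _ = B₁ * s * 1 := (mul_one _).symm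
      _ ≤ B₁ * s * (((L : ℝ) ^ j * η)⁻¹) ^ 2 := mul_le_mul_of_nonneg_left (one_le_pow₀ (hη1 j hj)) hB₁s.le
  · have hβ : β = 0 := le_antisymm hβ1 hβ0
    subst hβ
    calc hquot η 0 len (1 : Site d → Fin d → 𝔸ˣ) (covDerivFwd η (1 : Site d → Fin d → 𝔸ˣ) μ fun z => A z κ) q ≤ ‖η⁻¹‖ * (4 * B) :=
          hquot_zero_covDerivFwd_one_lineField_le η μ₀ a hA ha len μ κ q
      _ < B₂ * s := h3
      _ = B₂ * s * 1 := (mul_one _).symm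
      _ ≤ B₂ * s * (((L : ℝ) ^ j * η)⁻¹) ^ (2 + (0 : ℝ)) :=
          mul_le_mul_of_nonneg_left (Real.one_le_rpow (hη1 j hj) (by norm_num)) hB₂s.le

/-- ★ **(1.39) `C139T` FOR THE LINE FIELD AT `U₀ = 1`**: the plaquette member is `‖0‖ < B₁s(Lʲη)⁻³` (the field is CLOSED), the Laplacian member follows from
`‖η⁻¹‖²·4B < B₁s`. [cite: Balaban1985RegularSpaces, (1.39) p.83] -/
theorem c139T_one_lineField {L k : ℕ} (hη1 : ∀ j, j ≤ k → (1 : ℝ) ≤ ((L : ℝ) ^ j * η)⁻¹) {B₁ s : ℝ}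
    (h1 : B < B₁ * s) (h4 : ‖η⁻¹‖ * (‖η⁻¹‖ * (4 * B)) < B₁ * s) :
    C139T L k η B₁ s (1 : Site d → Fin d → 𝔸ˣ) A := by
  have hB : 0 ≤ B := (norm_nonneg _).trans (ha 0)
  have hB₁s : 0 < B₁ * s := lt_of_le_of_lt hB h1
  refine ⟨fun j hj x μ => ?_, fun j hj x κ => ?_⟩
  · rw [pdiv_plaqCovDeriv_one_lineField η μ₀ a hA, norm_zero]
    exact mul_pos hB₁s (pow_pos (lt_of_lt_of_le one_pos (hη1 j hj)) 3)
  · calc ‖covLap η (1 : Site d → Fin d → 𝔸ˣ) (fun z => A z κ) x‖ ≤ ‖η⁻¹‖ * (‖η⁻¹‖ * (4 * B)) := norm_covLap_one_lineField_le η μ₀ a hA ha κ x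
      _ < B₁ * s := h4
      _ = B₁ * s * 1 := (mul_one _).symm
      _ ≤ B₁ * s * (((L : ℝ) ^ j * η)⁻¹) ^ 3 := mul_le_mul_of_nonneg_left (one_le_pow₀ (hη1 j hj)) hB₁s.le

omit ha in
/-- ★★ **(1.38) IN THE MULTIPLIER FORM OF RECORD, `Ω₀ = ℤᵈ`, ONE AVERAGING LEVEL (`Λ = torusLam 1`), FOR THE LINE FIELD AT `U₀ = 1`**: `Δ^η_1 D^{η*}_1 A` is the longitudinal
site function of ✓`covLap_covDivB_one_lineField`, i.e. `η⁻³ •` the (negative) THIRD DIFFERENCE `S(m) = (a(m−1) − a(m)) − (a(m−2) − a(m−1)) − ((a(m) − a(m+1)) − (a(m−1) − a(m)))`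
of the profile; if `S` is BLOCK-CONSTANT — a function of `m ∕ L` — then it equals `Q′₁(1)ᵀμ` for the level-1 multiplier `μ 1 y := Lᵈ • η⁻³ • S(y_{μ₀})` (`μ 0 := 0`): one
transpose step `qprimeT1` at the trivial background is `ν ↦ L⁻ᵈ • ν(blockMap L ·)` (✓`bgT_one`), and `(blockMap L z)_{μ₀} = z_{μ₀} ∕ L`.
[cite: Balaban1985RegularSpaces, (1.38) p.82; Balaban1985BackgroundPropagators, (3.19) p.393, (3.24) p.394] -/
theorem isLandau138_one_lineField [CompleteSpace 𝔸] {L : ℕ} (hL : 0 < L) (S : ℤ → 𝔸)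
    (hS : ∀ m : ℤ, (a (m - 1) - a m) - (a (m - 1 - 1) - a (m - 1)) - ((a m - a (m + 1)) - (a (m - 1) - a m)) = S (m / (L : ℤ))) :
    IsLandau138 L 1 η (Set.univ : Set (Site d)) (torusLam 1) (1 : Site d → Fin d → 𝔸ˣ) A := by
  classical
  have hLd : ((L : ℝ) ^ d) ≠ 0 := by positivity
  refine ⟨fun j y => if j = 1 then ((L : ℝ) ^ d) • (η⁻¹ • (η⁻¹ • (η⁻¹ • S (y μ₀)))) else 0, fun x _ => ?_⟩
  rw [Set.indicator_univ, covLap_covDivB_one_lineField η μ₀ a hA]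
  have hE : η⁻¹ • (η⁻¹ • (η⁻¹ • (a (x μ₀ - 1) - a (x μ₀)) - η⁻¹ • (a (x μ₀ - 1 - 1) - a (x μ₀ - 1)))
        - η⁻¹ • (η⁻¹ • (a (x μ₀ + 1 - 1) - a (x μ₀ + 1)) - η⁻¹ • (a (x μ₀ - 1) - a (x μ₀))))
      = η⁻¹ • (η⁻¹ • (η⁻¹ • S (x μ₀ / (L : ℤ)))) := by
    simp only [add_sub_cancel_right, ← smul_sub]
    rw [hS]
  rw [hE]
  unfold QT
  rw [Finset.sum_range_succ, Finset.sum_range_succ, Finset.sum_range_zero, zero_add]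
  -- level 0: `Λ₀ = ∅`, the multiplier is not read
  have h0 : QprimeT L (1 : Site d → Fin d → 𝔸ˣ) 0
      ((torusLam 1 0).indicator ((fun (j : ℕ) (y : Site d) => if j = 1 then ((L : ℝ) ^ d) • (η⁻¹ • (η⁻¹ • (η⁻¹ • S (y μ₀)))) else 0) 0)) x = 0 := by
    rw [B8Thm4TorusAt.torusLam_of_ne (by norm_num : (0 : ℕ) ≠ 1), Set.indicator_empty]
    rfl
  -- level 1: one transpose step at the trivial background
  have h1 : QprimeT L (1 : Site d → Fin d → 𝔸ˣ) 1
      ((torusLam 1 1).indicator ((fun (j : ℕ) (y : Site d) => if j = 1 then ((L : ℝ) ^ d) • (η⁻¹ • (η⁻¹ • (η⁻¹ • S (y μ₀)))) else 0) 1)) x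
      = η⁻¹ • (η⁻¹ • (η⁻¹ • S (x μ₀ / (L : ℤ)))) := by
    rw [B8Thm4TorusAt.torusLam_self, Set.indicator_univ]
    show qprimeT1 L (1 : Site d → Fin d → 𝔸ˣ) 0 (fun y : Site d => if (1 : ℕ) = 1 then ((L : ℝ) ^ d) • (η⁻¹ • (η⁻¹ • (η⁻¹ • S (y μ₀)))) else 0) x
      = η⁻¹ • (η⁻¹ • (η⁻¹ • S (x μ₀ / (L : ℤ))))
    unfold qprimeT1
    rw [bgT_one]
    beta_reduce
    rw [if_pos rfl, inv_one, one_conjR, smul_smul, inv_mul_cancel₀ hLd, one_smul]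
    rfl
  rw [h0, h1, zero_add]

end Clauses

end Summit.QuantumFields.YangMills.Theorems.Prop7LineFieldZdLetters

end
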